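import Summits.BirchSwinnertonDyer.BirchSwinnertonDyer.Theorems.Rank1ResidualIntModelReduction
import Summits.BirchSwinnertonDyer.BirchSwinnertonDyer.Theorems.LeadingTermTamePinchRStubLocalTorsionTrivial
import Summits.BirchSwinnertonDyer.Rank1Residual.X11b.TamagawaQuadraticPlaces
import Literature.NumberTheory.EllipticCurves.PadicFiltrationIndexProofs
import Literature.NumberTheory.EllipticCurves.SingularCubicPointCountProofs
import Literature.NumberTheory.EllipticCurves.TamagawaRingEquivProofs
import Literature.NumberTheory.EllipticCurves.NonsplitProofs
import Literature.NumberTheory.EllipticCurves.QuadraticTwistLFunctionProofs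
import Literature.NumberTheory.EllipticCurves.ManinConstantAdditivePrimesProofs
import Literature.NumberTheory.EllipticCurves.Rank1Residual.Typed.X11Three
import HarnessLib

/-!
# `E(ℚ_p)[p] = 0` at a multiplicative prime: automatic when the reduction is non-split or `p ∤ v_p(Δ_min)` (hypothesis (iv) of Castella's erratum, decidable on the locus)

HONEST FRAMING (cell `b2b-bsdres`, run/shared/lean/b2b/bsd-rank1-residual/, verbatim in every
file): the goal of the cell is to DELETE the COMBINATION-SHAPED residual classes of the
Birch–Swinnerton-Dyer formula for ALL analytic-rank `≤ 1` elliptic curves over `ℚ` — "full BSD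
formula for every rank `≤ 1` curve in class `C`" assembled STRICTLY from published theorems — so
that the rank-`≤ 1` remainder becomes exactly the CONSTRUCTION-SHAPED classes, which are TYPED
(missing-input `Prop`s), NOT attempted. This is not "finishing BSD". Sub-cell
`b2b-bsdres-multr1-p1` (X11b, route R1); no claim beyond the stated class; X11b stays
CONSTRUCTION-SHAPED; nothing here changes a label; no named fact (theorems only; no `sorry`).

## What this file kernel-checks, and why

Hypothesis (iv) of the erratum's Thm. 1.1 / hypothesis (2) of Thm. A′ — "`E(ℚ_p)[p] = 0`" — is
carried by the cell's A′-locus `X11.AprimeLocusAt W p` (`Typed/X11Three.lean`) as the literal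
clause `∀ P : E(ℚ_p), p • P = 0 → P = 0`, and by route R1's `ErratumHypotheses` / `ChainLocus`
through it. The erratum (Remark after Thm. A′, p. 2) notes that for SPLIT multiplicative `p` it is
"condition (b) in [SZ14, Thm. 1.1]" (`p ∤ ord_p(q_E)` and `log_p(q_E) ∈ pℤ_p^×`); the cell's census
(`census500k/census.py`) decides it as: automatic when the reduction at `p` is NON-SPLIT, automatic
when it is split with `p ∤ v_p(Δ_min)`, and a Tate-period test only when `p ∣ v_p(Δ_min)`
(11 110 of the 1 357 341 `ChainLocus` pairs below `5·10⁵`, i.e. `0.8 %`). This file PROVES the two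
"automatic" cases, for every prime `p ≥ 3`, from the structure of `E(ℚ_p)` (Silverman, *AEC*
VII.2.1, VII.3.1, VII.6.1 = Kodaira–Néron, Ex. 3.5), all of which the tree already holds:

  `[E(ℚ_p) : E₁(ℚ_p)] = c_p · #Ẽ_ns(𝔽_p)`            (`index_formalFiltration`, level `1`),
  `E₁(ℚ_p)[p] = 0` for `p ≥ 3`                        (`not_prime_zsmul_eq_zero_of_one_lt_norm`),
  `c_p = v_p(Δ_min)` (split) / `c_p ∈ {1, 2}` (non-split)   (Kodaira–Néron, `NonsplitProofs`),
  `#Ẽ_ns(𝔽_p) = p − 1` (split) / `p + 1` (non-split)     (`natCard_point_of_Δ_eq_zero`),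

so that `p ∤ [E(ℚ_p) : E₁(ℚ_p)]` in the two cases, and a `p`-torsion point, pushed into `E₁(ℚ_p)` by
that index, dies there.

* `not_dvd_localTamagawaNumber_padic_of_mult` — `p ∤ c_p` at a multiplicative `p ≥ 3` that is
  non-split or has `p ∤ v_p(Δ_min)`;
* `reductionPointCount_of_mult` — `#Ẽ_ns(𝔽_p) + 1 = p` (split) resp. `#Ẽ_ns(𝔽_p) = p + 1`
  (non-split) for the tree's `reductionPointCount` at a multiplicative prime, and
  `not_dvd_reductionPointCount_of_mult` — `p ∤ #Ẽ_ns(𝔽_p)`;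
* `localTorsion_eq_zero_of_mult` — **THE THEOREM: for `W/ℚ` globally minimal elliptic and a prime
  `p ≥ 3` of multiplicative reduction, non-split or with `p ∤ v_p(Δ_min)`: every `P ∈ E(ℚ_p)` with
  `p • P = O` is `O`** (both the `ℕ`- and the `ℤ`-scalar spellings used in the tree);
* `X11.aprimeLocusAt_of_nonsplit` / `X11.aprimeLocusAt_of_not_dvd` — the A′-locus from its
  `q`-witness alone in the two cases (the local-torsion clause discharged);
  `ChainLocus`-level bookkeeping is left to `RouteLoci.lean`'s vocabulary (the clause sits inside
  `X11.AprimeRam2LocusAt`).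

Effect (bookkeeping; labels unchanged): on `99.2 %` of the `ChainLocus` census the side condition
(iv) is a THEOREM of the reduction type and `v_p(Δ_min)` — data already in the class predicate —
and only the split pairs with `p ∣ v_p(Δ_min)` keep a genuine local-torsion clause (there
`E(ℚ_p)[p] ≠ 0` does occur: `3 771` of `21 289` such pairs in the census).

References: J. H. Silverman, *The Arithmetic of Elliptic Curves*, 2nd ed. (2009), VII.2.1, VII.3.1,
VII.6.1, Ex. 3.5 [SilvermanAEC2009]; [Castella2018Erratum] Thm. 1.1 (iv), Thm. A′ (2) and Remark;
[SkinnerZhang2014] Thm. 1.1 (b).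
-/

noncomputable section

open scoped Classical

namespace Summit.BirchSwinnertonDyer.Rank1Residual.X11b.LocalTorsion

open WeierstrassCurve IsDedekindDomain NumberField Rat.HeightOneSpectrum Polynomial
  Literature.NumberTheory.EllipticCurves Literature.NumberTheory.EllipticCurves.Rank1Residual
  Literature.NumberTheory.EllipticCurves.Rank1Residual.Typed
  Summit.BirchSwinnertonDyer.BirchSwinnertonDyer.Rank1Residual.IntModel
  Summit.BirchSwinnertonDyer.BirchSwinnertonDyer.Theorems

variable (W : WeierstrassCurve ℚ) [W.IsElliptic] [W.IsGloballyMinimal] (p : ℕ) [hp : Fact p.Prime]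

/-! ### The place over `p` and the integer model -/

omit [W.IsGloballyMinimal] in
/-- The place of `𝓞 ℚ` over `p` and the multiplicative-reduction predicate moved to it. [folklore] -/
theorem exists_place_of_mult (hmult : Mult W p) :
    ∃ v : HeightOneSpectrum (𝓞 ℚ), (primesEquiv v : ℕ) = p ∧ W.HasMultiplicativeReductionAt v ∧
      (W.HasSplitMultiplicativeReductionAtPrime p ↔ W.HasSplitMultiplicativeReductionAt v) := by
  set v : HeightOneSpectrum (𝓞 ℚ) := (primesEquiv (R := 𝓞 ℚ)).symm ⟨p, hp.out⟩ with hvdef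
  have hv : primesEquiv v = ⟨p, hp.out⟩ := Equiv.apply_symm_apply _ _
  refine ⟨v, congrArg Subtype.val hv, ?_, ?_⟩
  · have key : ∀ q : Nat.Primes, primesEquiv v = q →
        (haveI := Fact.mk q.2; W.HasMultiplicativeReductionAtPrime (q : ℕ)) →
          W.HasMultiplicativeReductionAt v := by
      rintro q rfl h
      exact (WeierstrassCurve.hasMultiplicativeReductionAtPrime_iff_hasMultiplicativeReductionAt_ringOfIntegers
        W v).mp h
    exact key ⟨p, hp.out⟩ hv hmult
  · have key : ∀ q : Nat.Primes, primesEquiv v = q →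
        ((haveI := Fact.mk q.2; W.HasSplitMultiplicativeReductionAtPrime (q : ℕ)) ↔
          W.HasSplitMultiplicativeReductionAt v) := by
      rintro q rfl
      exact hasSplitMultiplicativeReductionAtPrime_iff_hasSplitMultiplicativeReductionAt W v
    exact key ⟨p, hp.out⟩ hv

/-- At a multiplicative prime, `p ∣ Δ(E₀)` and `p ∤ c₄(E₀)` for the integer model
`E₀ = integralModelInt W` (Silverman *AEC* VII.5.1(b) on the globally minimal equation).
[cite: SilvermanAEC2009, VII.5 Prop. 5.1(b)] -/
theorem dvd_Δ_and_not_dvd_c₄_of_mult (hmult : Mult W p) :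
    (p : ℤ) ∣ (integralModelInt W).Δ ∧ ¬ (p : ℤ) ∣ (integralModelInt W).c₄ := by
  obtain ⟨v, hvp, hmultv, -⟩ := exists_place_of_mult W p hmult
  have hmin : W.IsMinimalAt v := IsGloballyMinimal.isMinimalAt W v
  obtain ⟨hΔv, hc₄v⟩ := (hasMultiplicativeReductionAt_iff_of_isMinimalAt hmin).mp hmultv
  refine ⟨?_, ?_⟩
  · by_contra hnd
    have h1 : v.valuation ℚ W.Δ = 1 := by
      rw [Δ_eq_cast (W := W) rfl]
      exact valuation_ringOfIntegers_intCast_eq_one v (by rw [hvp]; exact hnd)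
    rw [h1] at hΔv
    exact lt_irrefl _ hΔv
  · intro hd
    have h1 : v.valuation ℚ W.c₄ < 1 := by
      rw [c₄_eq_cast (W := W) rfl]
      exact valuation_ringOfIntegers_intCast_lt_one v (by rw [hvp]; exact hd)
    rw [hc₄v] at h1
    exact lt_irrefl _ h1

/-! ### `p ∤ c_p` -/

/-- **`p ∤ c_p` at a multiplicative `p ≥ 3` that is non-split or has `p ∤ v_p(Δ_min)`**
(Kodaira–Néron: `c_p = v_p(Δ_min)` in the split case, `c_p ∈ {1, 2}` in the non-split case;
Silverman *AEC* Thm. VII.6.1, *ATAEC* IV.9.4 Step 2), for the Tamagawa number of `W/ℚ_p` computed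
in Mathlib's `ℚ_[p]` (`localTamagawaNumber_padic_eq_holds` moves it to the place `v ∣ p`).
[cite: SilvermanAEC2009, Thm VII.6.1] -/
theorem not_dvd_localTamagawaNumber_padic_of_mult (hp3 : 3 ≤ p) (hmult : Mult W p)
    (h : ¬ W.HasSplitMultiplicativeReductionAtPrime p ∨ ¬ p ∣ padicValInt p W.minimalDiscriminantInt) :
    ¬ p ∣ (W.baseChange ℚ_[p]).localTamagawaNumber ℤ_[p] := by
  obtain ⟨v, hvp, hmultv, hsplit⟩ := exists_place_of_mult W p hmult
  haveI : Finite (IsLocalRing.ResidueField (v.adicCompletionIntegers ℚ)) :=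
    HeightOneSpectrum.finite_residueField_adicCompletionIntegers ℚ v
  rw [localTamagawaNumber_padic_eq_holds W v p hvp]
  by_cases hs : W.HasSplitMultiplicativeReductionAt v
  · -- split: `c = ord_v(Δ_min) = v_p(Δ_min)`, and `p ∤` it by hypothesis
    have hns : ¬ p ∣ padicValInt p W.minimalDiscriminantInt := by
      rcases h with h | h
      · exact absurd (hsplit.mpr hs) h
      · exact h
    rw [(kodairaNeron_localTamagawaNumber W v).2.1 hs, ordMinimalDiscriminant_eq_padicValInt W v hvp]
    exact hns
  · -- non-split: `c ∈ {1, 2}`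
    rw [localTamagawaNumber_of_hasNonsplitMultiplicativeReductionAt_holds v W hmultv hs]
    intro hd
    split_ifs at hd
    · have := Nat.le_of_dvd two_pos hd; omega
    · have := Nat.le_of_dvd one_pos hd; omega

/-! ### `p ∤ #Ẽ_ns(𝔽_p)` -/

/-- **Point count at a multiplicative prime** (Silverman *AEC* Ex. 3.5: `Ẽ_ns(𝔽_p) ≅ 𝔽_pˣ` for a
split node, the norm-one torus of `𝔽_{p²}` for a non-split node): for the tree's
`reductionPointCount W p = #Ẽ_ns(𝔽_p)` (Mathlib's points of the reduced cubic: the nonsingular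
ones with `Õ`), `#Ẽ_ns(𝔽_p) + 1 = p` if the reduction is split and `#Ẽ_ns(𝔽_p) = p + 1` if it is
non-split (`natCard_point_of_Δ_eq_zero` with the split criterion
`hasSplitMultiplicativeReductionAtPrime_iff_splits`). [cite: SilvermanAEC2009, Exercise 3.5 (PDF p. 97)] -/
theorem reductionPointCount_of_mult (hmult : Mult W p) :
    (W.HasSplitMultiplicativeReductionAtPrime p → reductionPointCount W p + 1 = p) ∧
      (¬ W.HasSplitMultiplicativeReductionAtPrime p → reductionPointCount W p = p + 1) := by
  obtain ⟨hΔ, hc₄⟩ := dvd_Δ_and_not_dvd_c₄_of_mult W p hmult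
  set V : WeierstrassCurve (ZMod p) := (integralModelInt W).map (Int.castRingHom (ZMod p)) with hV
  have hΔV : V.Δ = 0 := by
    rw [hV, map_Δ, eq_intCast, ZMod.intCast_zmod_eq_zero_iff_dvd]
    exact hΔ
  have hc₄V : V.c₄ ≠ 0 := by
    rw [hV, map_c₄, eq_intCast, Ne, ZMod.intCast_zmod_eq_zero_iff_dvd]
    exact hc₄
  have hcount := V.natCard_point_of_Δ_eq_zero hΔV
  have hcrit := hasSplitMultiplicativeReductionAtPrime_iff_splits (W := W) rfl p hΔ hc₄
  have hcardk : Nat.card (ZMod p) = p := Nat.card_zmod p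
  refine ⟨fun hs => ?_, fun hns => ?_⟩
  · have h1 := hcount.1 hc₄V (hcrit.mp hs)
    rw [hcardk] at h1
    exact h1
  · have h1 := hcount.2.1 hc₄V (fun hsp => hns (hcrit.mpr hsp))
    rw [hcardk] at h1
    exact h1

/-- **`p ∤ #Ẽ_ns(𝔽_p)` at a multiplicative prime** (`#Ẽ_ns = p ∓ 1`). [cite: SilvermanAEC2009, Exercise 3.5 (PDF p. 97)] -/
theorem not_dvd_reductionPointCount_of_mult (hmult : Mult W p) : ¬ p ∣ reductionPointCount W p := by
  have hp' : p.Prime := hp.out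
  have h2 : 2 ≤ p := hp'.two_le
  obtain ⟨hs, hns⟩ := reductionPointCount_of_mult W p hmult
  intro hd
  by_cases h : W.HasSplitMultiplicativeReductionAtPrime p
  · have h1 := hs h
    have : p ∣ 1 := by
      have := (Nat.dvd_add_right hd).mp (by rw [h1])
      exact this
    exact hp'.one_lt.ne' (Nat.dvd_one.mp this)
  · have h1 := hns h
    rw [h1] at hd
    have : p ∣ 1 := (Nat.dvd_add_right (dvd_refl p)).mp hd
    exact hp'.one_lt.ne' (Nat.dvd_one.mp this)

/-! ### The theorem -/

omit [W.IsElliptic] in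
/-- The number of points of Mathlib's reduction of `W/ℚ_p` is the tree's `reductionPointCount W p`
(both are `integralModelInt W` read modulo `p`; `reduction_baseChange_eq`,
`natCard_point_padicModel_residue`). [folklore] -/
theorem natCard_point_reduction_baseChange_padic [(W.baseChange ℚ_[p]).IsMinimal ℤ_[p]] :
    Nat.card ((W.baseChange ℚ_[p]).reduction ℤ_[p]).toAffine.Point = reductionPointCount W p := by
  have key : ∀ (X : WeierstrassCurve ℚ_[p]) [X.IsMinimal ℤ_[p]],
      ((integralModelInt W).map (Int.castRingHom ℤ_[p])).baseChange ℚ_[p] = X →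
        Nat.card (X.reduction ℤ_[p]).toAffine.Point = reductionPointCount W p := by
    intro X _ hX
    subst hX
    rw [reduction_baseChange_eq]
    exact natCard_point_padicModel_residue W p
  exact key (W.baseChange ℚ_[p]) (padicModel_baseChange W p)

/-- **`E(ℚ_p)[p] = 0` at a multiplicative prime `p ≥ 3` that is non-split or has `p ∤ v_p(Δ_min)`.**
For `W/ℚ` elliptic and globally minimal and a prime `p ≥ 3` of multiplicative reduction which is
either NON-SPLIT or has `p ∤ v_p(Δ_min)`: every `ℚ_p`-point `P` with `p • P = O` is `O`. Proof:
`m • P ∈ E₁(ℚ_p)` for `m = [E(ℚ_p) : E₁(ℚ_p)] = c_p · #Ẽ_ns(𝔽_p)` (`index_formalFiltration`), and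
`E₁(ℚ_p)[p] = 0` (`stubC_eq_zero_of_isInReductionKernel`), so `m • P = O`; `p ∤ m`
(`not_dvd_localTamagawaNumber_padic_of_mult`, `not_dvd_reductionPointCount_of_mult`), hence
`P = O`. This is hypothesis (iv) "`E(ℚ_p)[p] = 0`" of the erratum's Thm. 1.1 / (2) of Thm. A′,
automatic in these two cases (the erratum's Remark identifies the remaining split case with
[SZ14, Thm. 1.1 (b)]). [cite: SilvermanAEC2009, VII.2 Prop. 2.1, VII.3 Prop. 3.1, Thm VII.6.1]
[cite: Castella2018Erratum, Thm. 1.1 (iv), Thm. A′ and Remark (pp. 1–2)] -/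
theorem localTorsion_eq_zero_of_mult (hp3 : 3 ≤ p) (hmult : Mult W p)
    (h : ¬ W.HasSplitMultiplicativeReductionAtPrime p ∨ ¬ p ∣ padicValInt p W.minimalDiscriminantInt)
    (P : (W.baseChange ℚ_[p]).toAffine.Point) (hP : p • P = 0) : P = 0 := by
  have hp' : p.Prime := hp.out
  haveI : (W.baseChange ℚ_[p]).IsMinimal ℤ_[p] := isMinimal_map_padic_of_isGloballyMinimal W p
  haveI : (W.baseChange ℚ_[p]).IsElliptic := by rw [baseChange]; infer_instance
  set m : ℕ := ((W.baseChange ℚ_[p]).formalFiltration 1).index with hm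
  -- `m = c_p · #Ẽ_ns(𝔽_p)`, prime to `p`
  have hidx : m = (W.baseChange ℚ_[p]).localTamagawaNumber ℤ_[p] * reductionPointCount W p := by
    rw [hm, index_formalFiltration (W.baseChange ℚ_[p]) (le_refl 1), pow_zero, mul_one,
      natCard_point_reduction_baseChange_padic]
  have hcop : ¬ p ∣ m := by
    rw [hidx]
    intro hd
    rcases (Nat.Prime.dvd_mul hp').mp hd with hc | hN
    · exact not_dvd_localTamagawaNumber_padic_of_mult W p hp3 hmult h hc
    · exact not_dvd_reductionPointCount_of_mult W p hmult hN
  -- `m • P ∈ E₁(ℚ_p)` and `p` kills it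
  have hmem : m • P ∈ (W.baseChange ℚ_[p]).formalFiltration 1 :=
    AddSubgroup.nsmul_index_mem _ P
  have hker : (W.baseChange ℚ_[p]).IsInReductionKernel (m • P) := hmem.1
  have hkill : (p : ℤ) • (m • P) = 0 := by
    rw [natCast_zsmul, smul_comm, hP, nsmul_zero]
  have hzero : m • P = 0 :=
    stubC_eq_zero_of_isInReductionKernel hp3 ((integralModelInt W).map (Int.castRingHom ℤ_[p]))
      (W.baseChange ℚ_[p]) (padicModel_baseChange W p) _ hker hkill
  exact stubC_eq_zero_of_zsmul_of_nsmul hp' hcop P (by rw [natCast_zsmul]; exact hP) hzero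

/-- The same with the `ℤ`-scalar spelling `(p : ℤ) • P = 0` (as in `KuriharaNumberKimCertificate`,
`LeadingTermTamePinchRStubLocalTorsionTrivial`). [cite: SilvermanAEC2009, VII.3 Prop. 3.1] -/
theorem localTorsion_eq_zero_of_mult_int (hp3 : 3 ≤ p) (hmult : Mult W p)
    (h : ¬ W.HasSplitMultiplicativeReductionAtPrime p ∨ ¬ p ∣ padicValInt p W.minimalDiscriminantInt)
    (P : (W.baseChange ℚ_[p]).toAffine.Point) (hP : (p : ℤ) • P = 0) : P = 0 :=
  localTorsion_eq_zero_of_mult W p hp3 hmult h P (by rw [← natCast_zsmul]; exact hP)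

/-- **Non-split multiplicative `p ≥ 3` ⟹ `E(ℚ_p)[p] = 0`.** [cite: SilvermanAEC2009, Thm VII.6.1 and Exercise 3.5] -/
theorem localTorsion_eq_zero_of_nonsplit (hp3 : 3 ≤ p) (hmult : Mult W p)
    (hns : ¬ W.HasSplitMultiplicativeReductionAtPrime p) :
    ∀ P : (W.baseChange ℚ_[p]).toAffine.Point, p • P = 0 → P = 0 :=
  fun P hP => localTorsion_eq_zero_of_mult W p hp3 hmult (Or.inl hns) P hP

/-- **Multiplicative `p ≥ 3` with `p ∤ v_p(Δ_min)` ⟹ `E(ℚ_p)[p] = 0`.** [cite: SilvermanAEC2009, Thm VII.6.1 and Exercise 3.5] -/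
theorem localTorsion_eq_zero_of_not_dvd (hp3 : 3 ≤ p) (hmult : Mult W p)
    (hv : ¬ p ∣ padicValInt p W.minimalDiscriminantInt) :
    ∀ P : (W.baseChange ℚ_[p]).toAffine.Point, p • P = 0 → P = 0 :=
  fun P hP => localTorsion_eq_zero_of_mult W p hp3 hmult (Or.inr hv) P hP

/-! ### The A′-locus with its local-torsion clause discharged -/

/-- **The A′-locus from its `q`-witness alone, non-split `p`.** For `W/ℚ` globally minimal
elliptic, `p ≥ 3` a prime of NON-SPLIT multiplicative reduction and a prime `q ≠ p` of non-split
multiplicative reduction with `p ∤ v_q(Δ_min)`: `X11.AprimeLocusAt W p` — the clause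
"`E(ℚ_p)[p] = 0`" of Castella's Thm. A′ is a theorem here (`localTorsion_eq_zero_of_nonsplit`).
[cite: Castella2018Erratum, Thm. A′ (p. 1), hypotheses] -/
theorem X11.aprimeLocusAt_of_nonsplit (hp3 : 3 ≤ p) (hmult : Mult W p)
    (hns : ¬ W.HasSplitMultiplicativeReductionAtPrime p)
    {q : ℕ} [Fact q.Prime] (hqp : q ≠ p) (hmq : Mult W q)
    (hnsq : ¬ W.HasSplitMultiplicativeReductionAtPrime q)
    (hvq : ¬ p ∣ padicValInt q W.minimalDiscriminantInt) : X11.AprimeLocusAt W p :=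
  ⟨⟨q, ‹_›, hqp, hmq, hnsq, hvq⟩, localTorsion_eq_zero_of_nonsplit W p hp3 hmult hns⟩

/-- **The A′-locus from its `q`-witness alone, `p ∤ v_p(Δ_min)`.** Same with `p` multiplicative
(split or not) and `p ∤ v_p(Δ_min)` (`localTorsion_eq_zero_of_not_dvd`).
[cite: Castella2018Erratum, Thm. A′ (p. 1), hypotheses] -/
theorem X11.aprimeLocusAt_of_not_dvd (hp3 : 3 ≤ p) (hmult : Mult W p)
    (hv : ¬ p ∣ padicValInt p W.minimalDiscriminantInt)
    {q : ℕ} [Fact q.Prime] (hqp : q ≠ p) (hmq : Mult W q)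
    (hnsq : ¬ W.HasSplitMultiplicativeReductionAtPrime q)
    (hvq : ¬ p ∣ padicValInt q W.minimalDiscriminantInt) : X11.AprimeLocusAt W p :=
  ⟨⟨q, ‹_›, hqp, hmq, hnsq, hvq⟩, localTorsion_eq_zero_of_not_dvd W p hp3 hmult hv⟩

end Summit.BirchSwinnertonDyer.Rank1Residual.X11b.LocalTorsion

end
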